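import Summits.CriticalPhenomena.SAWScalingLimit.Theorems.SAWDefectDecoherenceBoundaryClosureRPhaseSlit
import Summits.CriticalPhenomena.SAWScalingLimit.Theorems.SAWDefectDecoherenceBoundaryClosureRPhaseCornerGeometry
import HarnessLib

/-!
# Crux `BoundaryClosureR` (stmt-CriticalPhenomena-14004), line `polygon-parity-squeeze`,
# registered stub `exactPolygon_covers`: the FLAT / CORN covers of an exact polygon family

Glue lemma of the (A) assembly.  An exact polygon family `ExactPolygonFamily D Λ` comes with a finite
corner set `corners₀ ⊆ ∂Ω`, a radius `r`, and, eventually in `δ`, exact flat balls of radius `r/2`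
about the boundary points at distance `≥ r` from `corners₀` and lattice corners `IsCornerAt` of
radius `r` at the points of `corners₀`.  The consumers of the assembly (pieces D and E) need instead:

* FLAT data at EVERY boundary point `z ≠ a` off a finite set `corners` (a half-plane ball
  `Ω ∩ B(z,s) = H_k(z) ∩ B(z,s)`, eventually an exact single-form half-lattice on the ball, root
  outside the closed ball), including the points within `(0, r)` of a corner, and
* CORN data at every point of `corners` (a GENUINE corner: `n_{k'} ≠ ± n_k`, continuum `∩`/`∪`,
  eventually lattice `∧`/`∨`, root outside).

`exactPolygon_covers` produces them with `corners :=` the genuine corners of `corners₀`: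
* the presentations of `IsCornerAt` are classified (`corner_dichotomy`): genuine, or equal normals
  (a flat ball — such a point of `corners₀` is put in the flat class), or opposite normals, which is
  impossible (convex: `Ω ∩ B = ∅` at a closure point; reflex: a slit ball, refuted by the conformal
  frame, `PhaseChart.slit_false`);
* the forms of a flat ball / genuine corner ball are determined by the set
  (`PhaseGeometry.form_unique`, `corner_forms_unique`, `corner_forms_of_flat`), so the `δ`-dependent
  presentations of the family can be read in a FIXED frame (`lattice_of_flat_corner`,
  `lattice_of_genuine_corner`);
* at a boundary point `z ≠ c` in the ball of a genuine corner `c`, `z` lies on one of the two side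
  rays (`PhaseGeometry.level_eq_zero_or_of_mem_frontier`) and the landed threshold localisation
  `PolygonLocal.corner_side_flat` (pinning of the two thresholds, `corner_pinning`, from
  `AdmissibleFamily`) gives the single-form flat data (`flat_of_near_genuine_corner`);
* radii are finally shrunk below `dist(z, a)/2` (`flat_shrink`).

References: folklore (plane geometry of the six zigzag half-planes, honeycomb lattice); Pommerenke,
*Boundary Behaviour of Conformal Maps* (1992), Thm. 2.6 for the slit refutation (landed).
No definition is introduced.
-/

noncomputable section

open scoped Topology ComplexConjugate
open Filter Set Metric
open UpperHalfPlane (upperHalfPlaneSet)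
open Literature.Probability.LatticeModels Literature.Probability.RandomPlanarGeometry
open Literature.Probability.RandomPlanarGeometry.SAW

namespace Summit.CriticalPhenomena.SAWScalingLimit.Theorems.PolygonParitySqueeze

namespace ExactPolygonCovers

/-! ### 1. Classification of the presentations of a lattice corner -/

/-- **Dichotomy of the corners of an exact polygon with a conformal frame.**  A lattice corner
presentation `IsCornerAt D Λ₀ δ₀ c r` at a boundary point `c`, root outside `B(c, r)`, is either
GENUINE (`n_{k'} ≠ ± n_k`) or has equal normals, in which case `B(c, r)` is a flat ball; the
presentations with opposite normals are impossible (empty ball at a closure point, resp. a slit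
ball, refuted by the frame). [folklore] -/
theorem corner_dichotomy (D : DobrushinDomain) (Φ : ConformalEquiv D.carrier upperHalfPlaneSet)
    (hΦ0 : Tendsto (fun x => ‖Φ x‖) (𝓝[D.carrier] (D.pt 0)) atTop)
    {Λ₀ : Finset HexVertex} {δ₀ : ℝ} {c : ℂ} {r : ℝ} (hr : 0 < r) (hc : c ∈ frontier D.carrier)
    (h0 : D.pt 0 ∉ ball c r) (hC : IsCornerAt D Λ₀ δ₀ c r) :
    (∃ k k' : Fin 6, innerNormal k' ≠ innerNormal k ∧ innerNormal k' ≠ -innerNormal k ∧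
      (D.carrier ∩ ball c r = halfPlane k c ∩ halfPlane k' c ∩ ball c r ∨
        D.carrier ∩ ball c r = (halfPlane k c ∪ halfPlane k' c) ∩ ball c r)) ∨
    (∃ k : Fin 6, D.carrier ∩ ball c r = halfPlane k c ∩ ball c r) := by
  obtain ⟨k, k', n, n', hck⟩ := hC
  have hsetc : D.carrier ∩ ball c r = halfPlane k c ∩ halfPlane k' c ∩ ball c r ∨
      D.carrier ∩ ball c r = (halfPlane k c ∪ halfPlane k' c) ∩ ball c r :=
    hck.imp And.left And.left
  by_cases heq : innerNormal k' = innerNormal k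
  · right
    refine ⟨k, ?_⟩
    rcases hsetc with h | h
    · rw [h, PhaseGeometry.halfPlane_congr heq, inter_self]
    · rw [h, PhaseGeometry.halfPlane_congr heq, union_self]
  · by_cases hneg : innerNormal k' = -innerNormal k
    · exfalso
      rcases hsetc with h | h
      · rw [PhaseGeometry.inter_opp_eq_empty hneg, empty_inter] at h
        have hccl : c ∈ closure D.carrier := frontier_subset_closure hc
        obtain ⟨w, hw⟩ :=
          mem_closure_iff_nhds.1 hccl (ball c r) (isOpen_ball.mem_nhds (mem_ball_self hr))
        have : w ∈ D.carrier ∩ ball c r := ⟨hw.2, hw.1⟩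
        rw [h] at this
        exact this
      · rw [PhaseGeometry.union_opp_eq hneg] at h
        exact PhaseChart.slit_false D Φ hΦ0 (norm_innerNormal k) hr h h0
    · exact Or.inl ⟨k, k', heq, hneg, hsetc⟩

/-! ### 2. Reading the `δ`-dependent presentations in a fixed frame -/

/-- **Flat corner balls carry a single-form exact half-lattice.**  If `B(c, r)` is a flat ball of
form `k` and, eventually, `Λ_δ` is a lattice corner at `c` of radius `r`, then eventually `Λ_δ` is
an exact half-lattice of form `k` on the ball (both forms of every presentation equal `k`, and
`n ≤ f ∧ n' ≤ f ↔ max n n' ≤ f`, `n ≤ f ∨ n' ≤ f ↔ min n n' ≤ f`). [folklore] -/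
theorem lattice_of_flat_corner {D : DobrushinDomain} {Λ : ℝ → Finset HexVertex} {c : ℂ} {r : ℝ}
    (hr : 0 < r) {k : Fin 6} (hflat : D.carrier ∩ ball c r = halfPlane k c ∩ ball c r)
    (hev : ∀ᶠ δ : ℝ in 𝓝[>] 0, IsCornerAt D (Λ δ) δ c r) :
    ∀ᶠ δ : ℝ in 𝓝[>] 0, ∃ nthr : ℤ, ∀ v : HexVertex, (δ : ℂ) * hexCenter v ∈ ball c r →
      (v ∈ Λ δ ↔ nthr ≤ zigzagForm k v) := by
  filter_upwards [hev] with δ hδ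
  obtain ⟨k₂, k₂', n₂, n₂', hck₂⟩ := hδ
  obtain ⟨e1, e2⟩ := PhaseGeometry.corner_forms_of_flat hr hflat (hck₂.imp And.left And.left)
  subst e1 e2
  rcases hck₂ with ⟨-, hl⟩ | ⟨-, hl⟩
  · exact ⟨max n₂ n₂', fun v hv => by rw [hl v hv, max_le_iff]⟩
  · exact ⟨min n₂ n₂', fun v hv => by rw [hl v hv, min_le_iff]⟩

/-- **Genuine corner balls carry the two-form exact lattice in the given frame.**  If `B(c, r)` is
a genuine corner ball of forms `(k, k')` and, eventually, `Λ_δ` is a lattice corner at `c` of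
radius `r`, then eventually `Λ_δ` is the `∧` or the `∨` of two exact half-lattices of forms `k`,
`k'` IN THIS ORDER (the unordered pair of forms of a presentation is determined by the set).
[folklore] -/
theorem lattice_of_genuine_corner {D : DobrushinDomain} {Λ : ℝ → Finset HexVertex} {c : ℂ}
    {r : ℝ} (hr : 0 < r) {k k' : Fin 6} (hk : innerNormal k' ≠ innerNormal k)
    (hk' : innerNormal k' ≠ -innerNormal k)
    (hset : D.carrier ∩ ball c r = halfPlane k c ∩ halfPlane k' c ∩ ball c r ∨
      D.carrier ∩ ball c r = (halfPlane k c ∪ halfPlane k' c) ∩ ball c r)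
    (hev : ∀ᶠ δ : ℝ in 𝓝[>] 0, IsCornerAt D (Λ δ) δ c r) :
    ∀ᶠ δ : ℝ in 𝓝[>] 0, ∃ nk nk' : ℤ,
      (∀ v : HexVertex, (δ : ℂ) * hexCenter v ∈ ball c r →
        (v ∈ Λ δ ↔ (nk ≤ zigzagForm k v ∧ nk' ≤ zigzagForm k' v))) ∨
      (∀ v : HexVertex, (δ : ℂ) * hexCenter v ∈ ball c r →
        (v ∈ Λ δ ↔ (nk ≤ zigzagForm k v ∨ nk' ≤ zigzagForm k' v))) := by
  filter_upwards [hev] with δ hδ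
  obtain ⟨k₂, k₂', n₂, n₂', hck₂⟩ := hδ
  rcases PhaseGeometry.corner_forms_unique hr hk hk' hset (hck₂.imp And.left And.left) with
    ⟨e1, e2⟩ | ⟨e1, e2⟩
  · subst e1 e2
    rcases hck₂ with ⟨-, hl⟩ | ⟨-, hl⟩
    · exact ⟨n₂, n₂', Or.inl hl⟩
    · exact ⟨n₂, n₂', Or.inr hl⟩
  · subst e1 e2
    rcases hck₂ with ⟨-, hl⟩ | ⟨-, hl⟩
    · exact ⟨n₂', n₂, Or.inl fun v hv => by rw [hl v hv, and_comm]⟩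
    · exact ⟨n₂', n₂, Or.inr fun v hv => by rw [hl v hv, or_comm]⟩

/-! ### 3. Flat data near a genuine corner; shrinking the radius -/

/-- **Single-form flat data at the boundary points of a genuine corner ball other than the apex**:
such a point lies on one of the two side rays, and the threshold localisation
`PolygonLocal.corner_side_flat` applies in the frame `(k, k')` or `(k', k)`. [folklore] -/
theorem flat_of_near_genuine_corner {D : DobrushinDomain} {ρ : ℝ} {Λ : ℝ → Finset HexVertex}
    {m : ℝ → ℤ} {b : ℝ → Sym2 HexVertex} (hAF : AdmissibleFamily D ρ Λ m b) {c : ℂ} {r : ℝ}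
    (hr : 0 < r) {k k' : Fin 6} (hk : innerNormal k' ≠ innerNormal k)
    (hk' : innerNormal k' ≠ -innerNormal k)
    (hset : D.carrier ∩ ball c r = halfPlane k c ∩ halfPlane k' c ∩ ball c r ∨
      D.carrier ∩ ball c r = (halfPlane k c ∪ halfPlane k' c) ∩ ball c r)
    (hlat : ∀ᶠ δ : ℝ in 𝓝[>] 0, ∃ nk nk' : ℤ,
      (∀ v : HexVertex, (δ : ℂ) * hexCenter v ∈ ball c r →
        (v ∈ Λ δ ↔ (nk ≤ zigzagForm k v ∧ nk' ≤ zigzagForm k' v))) ∨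
      (∀ v : HexVertex, (δ : ℂ) * hexCenter v ∈ ball c r →
        (v ∈ Λ δ ↔ (nk ≤ zigzagForm k v ∨ nk' ≤ zigzagForm k' v))))
    {z : ℂ} (hz : z ∈ frontier D.carrier) (hzr : z ∈ ball c r) (hzc : z ≠ c) :
    ∃ (j : Fin 6) (s₁ : ℝ), 0 < s₁ ∧ D.carrier ∩ ball z s₁ = halfPlane j z ∩ ball z s₁ ∧
      ∀ᶠ δ : ℝ in 𝓝[>] 0, ∃ nthr : ℤ, ∀ v : HexVertex, (δ : ℂ) * hexCenter v ∈ ball z s₁ →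
        (v ∈ Λ δ ↔ nthr ≤ zigzagForm j v) := by
  rcases PhaseGeometry.level_eq_zero_or_of_mem_frontier D.isOpen hset hz hzr with hl | hl
  · obtain ⟨h1, -, h3, h4⟩ := PolygonLocal.corner_side_flat hAF hr hk hk' hset hlat hz hzr hzc hl
    exact ⟨k, _, h1, h3, h4⟩
  · have hk2 : innerNormal k ≠ -innerNormal k' := fun h => hk' (by rw [h, neg_neg])
    have hset' : D.carrier ∩ ball c r = halfPlane k' c ∩ halfPlane k c ∩ ball c r ∨
        D.carrier ∩ ball c r = (halfPlane k' c ∪ halfPlane k c) ∩ ball c r := by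
      rcases hset with h | h
      · left; rw [h, inter_comm (halfPlane k c)]
      · right; rw [h, union_comm]
    have hlat' : ∀ᶠ δ : ℝ in 𝓝[>] 0, ∃ nk nk' : ℤ,
        (∀ v : HexVertex, (δ : ℂ) * hexCenter v ∈ ball c r →
          (v ∈ Λ δ ↔ (nk ≤ zigzagForm k' v ∧ nk' ≤ zigzagForm k v))) ∨
        (∀ v : HexVertex, (δ : ℂ) * hexCenter v ∈ ball c r →
          (v ∈ Λ δ ↔ (nk ≤ zigzagForm k' v ∨ nk' ≤ zigzagForm k v))) := by
      filter_upwards [hlat] with δ ⟨nk, nk', h⟩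
      rcases h with h | h
      · exact ⟨nk', nk, Or.inl fun v hv => by rw [h v hv, and_comm]⟩
      · exact ⟨nk', nk, Or.inr fun v hv => by rw [h v hv, or_comm]⟩
    obtain ⟨h1, -, h3, h4⟩ :=
      PolygonLocal.corner_side_flat hAF hr hk.symm hk2 hset' hlat' hz hzr hzc hl
    exact ⟨k', _, h1, h3, h4⟩

/-- **Shrinking a flat ball below half the distance to the root.** [folklore] -/
theorem flat_shrink {D : DobrushinDomain} {Λ : ℝ → Finset HexVertex} {z : ℂ} (hz0 : z ≠ D.pt 0)
    {k : Fin 6} {s₁ : ℝ} (hs₁ : 0 < s₁)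
    (hflat : D.carrier ∩ ball z s₁ = halfPlane k z ∩ ball z s₁)
    (hlat : ∀ᶠ δ : ℝ in 𝓝[>] 0, ∃ nthr : ℤ, ∀ v : HexVertex, (δ : ℂ) * hexCenter v ∈ ball z s₁ →
      (v ∈ Λ δ ↔ nthr ≤ zigzagForm k v)) :
    ∃ (k : Fin 6) (s : ℝ), 0 < s ∧ D.carrier ∩ ball z s = halfPlane k z ∩ ball z s ∧
      (∀ᶠ δ : ℝ in 𝓝[>] 0, ∃ nthr : ℤ, ∀ v : HexVertex, (δ : ℂ) * hexCenter v ∈ ball z s →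
        (v ∈ Λ δ ↔ nthr ≤ zigzagForm k v)) ∧ D.pt 0 ∉ closedBall z s := by
  have hdp : 0 < dist z (D.pt 0) := dist_pos.2 hz0
  have hs0 : 0 < min s₁ (dist z (D.pt 0) / 2) := lt_min hs₁ (half_pos hdp)
  have hsub : ball z (min s₁ (dist z (D.pt 0) / 2)) ⊆ ball z s₁ := ball_subset_ball (min_le_left _ _)
  refine ⟨k, min s₁ (dist z (D.pt 0) / 2), hs0,
    PhaseGeometry.inter_eq_inter_of_subset_ball hflat hsub, ?_, fun h => ?_⟩
  · filter_upwards [hlat] with δ ⟨n, hn⟩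
    exact ⟨n, fun v hv => hn v (hsub hv)⟩
  · have h1 := mem_closedBall'.1 h
    have h2 := min_le_right s₁ (dist z (D.pt 0) / 2)
    linarith

end ExactPolygonCovers

/-- **Registered stub `exactPolygon_covers`** (glue lemma of the (A) assembly, crux
stmt-CriticalPhenomena-14004, line `polygon-parity-squeeze`): from an exact polygon admissible
pinned datum and a conformal frame `Φ : Ω → ℍₒ` with `‖Φ‖ → ∞` at the root, a finite set
`corners ⊆ ∂Ω` (the genuine corners of the family) with FLAT data — half-plane ball, eventually an
exact single-form half-lattice, root outside — at every other boundary point `z ≠ a`, and CORN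
data — genuine two-form corner ball, eventually the `∧`/`∨` exact lattice, root outside — at every
point of `corners`.  (The root pin, the separation of the pins and the root family are not needed:
the family's flat balls already cover the boundary near the two pins.) [folklore] -/
theorem exactPolygon_covers : ∀ (D : DobrushinDomain) (ρ : ℝ) (Λ : ℝ → Finset HexVertex) (m : ℝ → ℤ) (b : ℝ → Sym2 HexVertex), AdmissibleFamily D ρ Λ m b → ExactPolygonFamily D Λ → ∀ (a : ℝ → Sym2 HexVertex) (r₀ : ℝ) (m₀ : ℝ → ℤ), PinnedFlatRoot D Λ b (D.pt 0) a r₀ m₀ → 2 * ρ < dist (D.pt 0) (D.pt 1) → ∀ (Φ : ConformalEquiv D.carrier UpperHalfPlane.upperHalfPlaneSet), Filter.Tendsto (fun x => ‖Φ x‖) (𝓝[D.carrier] (D.pt 0)) Filter.atTop → ∃ corners : Finset ℂ, (↑corners : Set ℂ) ⊆ frontier D.carrier ∧ (∀ z ∈ frontier D.carrier, z ≠ D.pt 0 → z ∉ corners → ∃ (k : Fin 6) (s : ℝ), 0 < s ∧ D.carrier ∩ Metric.ball z s = halfPlane k z ∩ Metric.ball z s ∧ (∀ᶠ δ : ℝ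 in 𝓝[>] 0, ∃ nthr : ℤ, ∀ v : HexVertex, (δ : ℂ) * hexCenter v ∈ Metric.ball z s → (v ∈ Λ δ ↔ nthr ≤ zigzagForm k v)) ∧ D.pt 0 ∉ Metric.closedBall z s) ∧ (∀ c ∈ corners, ∃ (k k' : Fin 6) (s : ℝ), 0 < s ∧ innerNormal k' ≠ innerNormal k ∧ innerNormal k' ≠ -innerNormal k ∧ (D.carrier ∩ Metric.ball c s = halfPlane k c ∩ halfPlane k' c ∩ Metric.ball c s ∨ D.carrier ∩ Metric.ball c s = (halfPlane k c ∪ halfPlane k' c) ∩ Metric.ball c s) ∧ (∀ᶠ δ : ℝ in 𝓝[>] 0, ∃ nk nk' : ℤ, (∀ v : HexVertex, (δ : ℂ) * hexCenter v ∈ Metric.ball c s → (v ∈ Λ δ ↔ (nk ≤ zigzagForm k v ∧ nk' ≤ zigzagForm k' v))) ∨ (∀ v : HexVertex, (δ : ℂ) * hexCenter v ∈ Metric.ball c s → (v ∈ Λ δ ↔ (nk ≤ zigzagForm k v ∨ nk' ≤ zigzagForm k' v)))) ∧ D.pt 0 ∉ Metric.closedBall c s) := by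
  intro D ρ Λ m b hAF hEx _ _ _ _ _ Φ hΦ0
  classical
  obtain ⟨corners₀, r, hr, hcf, hdist, hev⟩ := hEx
  obtain ⟨δ₀, hδ₀⟩ := hev.exists
  have hU : IsOpen D.carrier := D.isOpen
  have h0c : ∀ c ∈ corners₀, D.pt 0 ∉ ball c r := fun c hc h =>
    not_lt.2 (hdist 0 c hc) (mem_ball.1 h)
  have hevC : ∀ c ∈ corners₀, ∀ᶠ δ : ℝ in 𝓝[>] 0, IsCornerAt D (Λ δ) δ c r := fun c hc => by
    filter_upwards [hev] with δ hδ
    exact (hδ c (hcf hc)).2 hc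
  have hdich : ∀ c ∈ corners₀,
      (∃ k k' : Fin 6, innerNormal k' ≠ innerNormal k ∧ innerNormal k' ≠ -innerNormal k ∧
        (D.carrier ∩ ball c r = halfPlane k c ∩ halfPlane k' c ∩ ball c r ∨
          D.carrier ∩ ball c r = (halfPlane k c ∪ halfPlane k' c) ∩ ball c r)) ∨
      (∃ k : Fin 6, D.carrier ∩ ball c r = halfPlane k c ∩ ball c r) := fun c hc =>
    ExactPolygonCovers.corner_dichotomy D Φ hΦ0 hr (hcf hc) (h0c c hc) ((hδ₀ c (hcf hc)).2 hc)
  refine ⟨corners₀.filter (fun c => ∃ k k' : Fin 6, innerNormal k' ≠ innerNormal k ∧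
      innerNormal k' ≠ -innerNormal k ∧
      (D.carrier ∩ ball c r = halfPlane k c ∩ halfPlane k' c ∩ ball c r ∨
        D.carrier ∩ ball c r = (halfPlane k c ∪ halfPlane k' c) ∩ ball c r)), ?_, ?_, ?_⟩
  · intro c hc
    exact hcf (Finset.mem_filter.1 hc).1
  · intro z hz hz0 hzc
    by_cases hfar : ∀ c ∈ corners₀, r ≤ dist z c
    · -- a flat side point of the family
      obtain ⟨k₀, n₀, hset₀, -⟩ := (hδ₀ z hz).1 hfar
      refine ExactPolygonCovers.flat_shrink hz0 (half_pos hr) hset₀ ?_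
      filter_upwards [hev] with δ hδ
      obtain ⟨k₂, n₂, hset₂, hlat₂⟩ := (hδ z hz).1 hfar
      have hk : k₂ = k₀ := PhaseGeometry.form_unique (half_pos hr) (hset₂.symm.trans hset₀)
      subst hk
      exact ⟨n₂, hlat₂⟩
    · push Not at hfar
      obtain ⟨c, hc, hzc'⟩ := hfar
      have hzball : z ∈ ball c r := mem_ball.2 hzc'
      rcases hdich c hc with ⟨k, k', hk, hk', hset⟩ | ⟨k, hflat⟩
      · -- near a genuine corner, off the apex
        have hcmem : c ∈ corners₀.filter (fun c => ∃ k k' : Fin 6, innerNormal k' ≠ innerNormal k ∧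
            innerNormal k' ≠ -innerNormal k ∧
            (D.carrier ∩ ball c r = halfPlane k c ∩ halfPlane k' c ∩ ball c r ∨
              D.carrier ∩ ball c r = (halfPlane k c ∪ halfPlane k' c) ∩ ball c r)) :=
          Finset.mem_filter.2 ⟨hc, k, k', hk, hk', hset⟩
        have hne : z ≠ c := fun h => hzc (by rw [h]; exact hcmem)
        obtain ⟨j, s₁, hs₁, hflat₁, hlat₁⟩ :=
          ExactPolygonCovers.flat_of_near_genuine_corner hAF hr hk hk' hset
            (ExactPolygonCovers.lattice_of_genuine_corner hr hk hk' hset (hevC c hc)) hz hzball hne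
        exact ExactPolygonCovers.flat_shrink hz0 hs₁ hflat₁ hlat₁
      · -- in a flat corner ball (possibly at its centre)
        have hlev : ((z - c) * conj (innerNormal k)).re = 0 :=
          PhaseGeometry.level_eq_zero_of_mem_frontier hU hflat hz hzball
        have hgap : 0 < r - dist z c := by linarith
        have hsub : ball z (r - dist z c) ⊆ ball c r := fun w hw => by
          rw [mem_ball] at hw ⊢
          linarith [dist_triangle w z c]
        refine ExactPolygonCovers.flat_shrink hz0 hgap (PhaseGeometry.flat_of_subset hflat hsub hlev) ?_
        filter_upwards [ExactPolygonCovers.lattice_of_flat_corner hr hflat (hevC c hc)] with δ ⟨n, hn⟩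
        exact ⟨n, fun v hv => hn v (hsub hv)⟩
  · intro c hcm
    obtain ⟨hc, k, k', hk, hk', hset⟩ := Finset.mem_filter.1 hcm
    have hsub : ball c (r / 2) ⊆ ball c r := ball_subset_ball (by linarith)
    refine ⟨k, k', r / 2, half_pos hr, hk, hk',
      hset.imp (fun h => PhaseGeometry.inter_eq_inter_of_subset_ball h hsub)
        (fun h => PhaseGeometry.inter_eq_inter_of_subset_ball h hsub), ?_, fun h => ?_⟩
    · filter_upwards [ExactPolygonCovers.lattice_of_genuine_corner hr hk hk' hset (hevC c hc)] with
        δ ⟨nk, nk', h⟩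
      exact ⟨nk, nk', h.imp (fun h v hv => h v (hsub hv)) (fun h v hv => h v (hsub hv))⟩
    · have h1 := mem_closedBall.1 h
      have h2 := hdist 0 c hc
      linarith

end Summit.CriticalPhenomena.SAWScalingLimit.Theorems.PolygonParitySqueeze

end
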